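import Mathlib
import HarnessLib
import Literature.NumberTheory.LFunctions.TaoEntropyDecrement
import Summits.Parity.BatemanHorn.Theses.AlmostPrimeZeros

/-!
# Crux `DiscMajorantLog` (stmt-Parity-17114), line `Sketch`: stub `stub_rightHalfTwinOfDisc`

Barrier lemma "the right half-disc majorant is twin-BLIND" (a registered stub of the line skeleton
`Cruxes/DiscMajorantLog/Lines/Sketch.lean`).

Let `S_x(z) = Σ_{0 ≤ n ≤ x} z^{s_f(n)}` be the almost-prime polynomial of a Bateman–Horn system `f`
(`s_f(n) = Σ_i Σ_{p^v ∥ f_i(n)} min(v, 2)`).  The crux `DiscMajorantLog` is the disc majorant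
`‖S_x(z)‖ ≤ A x P(z) E(C, r)`, `P(z) := (log x)^{k(Re z − 1)}`, `E(C, r) := e^{C r log(r+2)}`,
`r := ‖z − 1‖`, on `r ≤ 3 log log x` for `x ≥ x₀`.  We show that it implies the SAME kind of bound for
the parity twin `E_x(z) = S_x(z) + S_x(−z)` on the closed right half `0 ≤ Re z` of the slightly
smaller disc `r + 2 ≤ 3 log log x`.

Proof (triangle inequality and the hypothesis at `z` and at `−z`).  Put `A' = max A 0`,
`C' = max C 0` and take `x ≥ max x₀ 16`, so that `log x ≥ 1` (tree lemma
`Literature.NumberTheory.LFunctions.Tao2016.EntropyDecrement.one_le_log`).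
* At `z`: `‖S_x(z)‖ ≤ A x P(z) E(C, r) ≤ A' x P(z) E(4C', r)`.
* At `−z`: `r' := ‖−z − 1‖ ≤ r + 2 ≤ 3 log log x`, so the hypothesis applies; since `0 ≤ Re z` and
  `log x ≥ 1`, `(log x)^{k(Re(−z) − 1)} ≤ P(z)`; and `r' log(r'+2) ≤ (r+2) log(r+4) ≤ 4 r log(r+2) + 3`
  (from `log(r+4) ≤ log 2 + log(r+2)`, `log(r+2) ≤ log 2 + r/2`, `log 2 ∈ (1/2, 7/10)`), whence
  `‖S_x(−z)‖ ≤ A' x P(z) e^{3C'} E(4C', r)`.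
* Adding: `‖E_x(z)‖ ≤ A'(1 + e^{3C'}) · x · P(z) · E(4C', r)`.

No number theory is used: the Bateman–Horn hypothesis is only passed to `DiscMajorantLog`.
-/

noncomputable section

namespace Summit.Parity.BatemanHorn.Cruxes.DiscMajorantLog.Sketch

open Summit.Parity.BatemanHorn.Theses.AlmostPrimeZeros

namespace RightHalfTwinOfDisc

/-- The twin point lies in the shifted disc: `‖−z − 1‖ ≤ ‖z − 1‖ + 2`. [folklore] -/
theorem norm_neg_sub_one_le (z : ℂ) : ‖-z - 1‖ ≤ ‖z - 1‖ + 2 := by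
  calc ‖-z - 1‖ = ‖-(z - 1) - 2‖ := by congr 1; ring
    _ ≤ ‖-(z - 1)‖ + ‖(2 : ℂ)‖ := norm_sub_le _ _
    _ = ‖z - 1‖ + 2 := by rw [norm_neg, Complex.norm_two]

/-- Monotonicity of the majorant `A · P · e^{C r log(r+2)}` in its two constants (`A ≤ A'`,
`C ≤ C'`, `0 ≤ A'`, `0 ≤ P`, `0 ≤ r`). [folklore] -/
theorem constants_mono {A A' C C' P r : ℝ} (hA : A ≤ A') (hA' : 0 ≤ A') (hC : C ≤ C')
    (hP : 0 ≤ P) (hr : 0 ≤ r) :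
    A * P * Real.exp (C * r * Real.log (r + 2)) ≤ A' * P * Real.exp (C' * r * Real.log (r + 2)) := by
  -- adapted from the line skeleton's `majorant_mono`
  have hrl : 0 ≤ r * Real.log (r + 2) := mul_nonneg hr (Real.log_nonneg (by linarith))
  have hexp : Real.exp (C * r * Real.log (r + 2)) ≤ Real.exp (C' * r * Real.log (r + 2)) := by
    apply Real.exp_le_exp.2
    have : C * (r * Real.log (r + 2)) ≤ C' * (r * Real.log (r + 2)) :=
      mul_le_mul_of_nonneg_right hC hrl
    simpa [mul_assoc] using this
  calc A * P * Real.exp (C * r * Real.log (r + 2))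
      ≤ A' * P * Real.exp (C * r * Real.log (r + 2)) := by gcongr
    _ ≤ A' * P * Real.exp (C' * r * Real.log (r + 2)) :=
        mul_le_mul_of_nonneg_left hexp (mul_nonneg hA' hP)

/-- The Γ-budget at the shifted radius: `(r + 2) log(r + 4) ≤ 4 r log(r + 2) + 3` for `r ≥ 0`
(`log(r+4) ≤ log 2 + log(r+2)`, `log(r+2) ≤ log 2 + r/2`, `1/2 < log 2 < 7/10`). [folklore] -/
theorem budget_shift {r : ℝ} (hr : 0 ≤ r) :
    (r + 2) * Real.log (r + 4) ≤ 4 * r * Real.log (r + 2) + 3 := by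
  have hl2 := Real.log_two_gt_d9
  have hl2' := Real.log_two_lt_d9
  have hl : Real.log 2 ≤ Real.log (r + 2) := Real.log_le_log two_pos (by linarith)
  have h4 : Real.log (r + 4) ≤ Real.log 2 + Real.log (r + 2) := by
    rw [← Real.log_mul two_ne_zero (by linarith)]
    exact Real.log_le_log (by linarith) (by linarith)
  have hc : Real.log (r + 2) ≤ Real.log 2 + r / 2 := by
    have h := Real.log_le_sub_one_of_pos (show 0 < 1 + r / 2 by linarith)
    have : Real.log (r + 2) = Real.log 2 + Real.log (1 + r / 2) := by
      rw [← Real.log_mul two_ne_zero (by linarith)]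
      congr 1
      ring
    linarith
  have p1 : (r + 2) * Real.log (r + 4) ≤ (r + 2) * (Real.log 2 + Real.log (r + 2)) :=
    mul_le_mul_of_nonneg_left h4 (by linarith)
  have p2 : r * Real.log 2 ≤ r * Real.log (r + 2) := mul_le_mul_of_nonneg_left hl hr
  have p3 : r * (1 / 2) ≤ r * Real.log (r + 2) := mul_le_mul_of_nonneg_left (by linarith) hr
  nlinarith

/-- Real-variable assembly of the twin bound.  From the majorant at `z` (`S₁`, exponent factor `P`,
radius `r`) and at `−z` (`S₂`, exponent factor `P' ≤ P`, radius `r' ≤ r + 2`):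
`S₁ + S₂ ≤ max A 0 · (1 + e^{3 max C 0}) · X · P · e^{4 max C 0 · r log(r+2)}`. [folklore] -/
theorem twin_assemble {S₁ S₂ A C X P P' r r' : ℝ}
    (h₁ : S₁ ≤ A * X * P * Real.exp (C * r * Real.log (r + 2)))
    (h₂ : S₂ ≤ A * X * P' * Real.exp (C * r' * Real.log (r' + 2)))
    (hX : 0 ≤ X) (hP : 0 ≤ P) (hP'0 : 0 ≤ P') (hP' : P' ≤ P) (hr : 0 ≤ r) (hr'0 : 0 ≤ r')
    (hr' : r' ≤ r + 2) :
    S₁ + S₂ ≤ max A 0 * (1 + Real.exp (3 * max C 0)) * X * P *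
      Real.exp (4 * max C 0 * r * Real.log (r + 2)) := by
  set A' := max A 0 with hA'def
  set C' := max C 0 with hC'def
  have hA : A ≤ A' := le_max_left _ _
  have hA0 : 0 ≤ A' := le_max_right _ _
  have hC : C ≤ C' := le_max_left _ _
  have hC0 : 0 ≤ C' := le_max_right _ _
  have hXP : 0 ≤ X * P := mul_nonneg hX hP
  -- the bound at `z`
  have h1' : S₁ ≤ A' * (X * P) * Real.exp (4 * C' * r * Real.log (r + 2)) :=
    calc S₁ ≤ A * X * P * Real.exp (C * r * Real.log (r + 2)) := h₁
      _ = A * (X * P) * Real.exp (C * r * Real.log (r + 2)) := by ring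
      _ ≤ A' * (X * P) * Real.exp (4 * C' * r * Real.log (r + 2)) :=
          constants_mono hA hA0 (by linarith) hXP hr
  -- the bound at `−z`
  have h2' : S₂ ≤ A' * (X * P) * (Real.exp (3 * C') * Real.exp (4 * C' * r * Real.log (r + 2))) :=
    calc S₂ ≤ A * X * P' * Real.exp (C * r' * Real.log (r' + 2)) := h₂
      _ = A * (X * P') * Real.exp (C * r' * Real.log (r' + 2)) := by ring
      _ ≤ A' * (X * P') * Real.exp (C' * r' * Real.log (r' + 2)) :=
          constants_mono hA hA0 hC (mul_nonneg hX hP'0) hr'0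
      _ ≤ A' * (X * P) * Real.exp (C' * ((r + 2) * Real.log (r + 4))) := by
          have hE : Real.exp (C' * r' * Real.log (r' + 2)) ≤
              Real.exp (C' * ((r + 2) * Real.log (r + 4))) := by
            apply Real.exp_le_exp.2
            rw [mul_assoc]
            apply mul_le_mul_of_nonneg_left _ hC0
            have hlog : Real.log (r' + 2) ≤ Real.log (r + 4) :=
              Real.log_le_log (by linarith) (by linarith)
            exact mul_le_mul hr' hlog (Real.log_nonneg (by linarith)) (by linarith)
          have hXP' : A' * (X * P') ≤ A' * (X * P) :=
            mul_le_mul_of_nonneg_left (mul_le_mul_of_nonneg_left hP' hX) hA0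
          exact mul_le_mul hXP' hE (Real.exp_pos _).le (mul_nonneg hA0 hXP)
      _ ≤ A' * (X * P) * (Real.exp (3 * C') * Real.exp (4 * C' * r * Real.log (r + 2))) := by
          have hE : Real.exp (C' * ((r + 2) * Real.log (r + 4))) ≤
              Real.exp (3 * C') * Real.exp (4 * C' * r * Real.log (r + 2)) := by
            rw [← Real.exp_add]
            apply Real.exp_le_exp.2
            have hk := mul_le_mul_of_nonneg_left (budget_shift hr) hC0
            linarith
          exact mul_le_mul_of_nonneg_left hE (mul_nonneg hA0 hXP)
  -- add
  calc S₁ + S₂ ≤ A' * (X * P) * Real.exp (4 * C' * r * Real.log (r + 2)) +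
        A' * (X * P) * (Real.exp (3 * C') * Real.exp (4 * C' * r * Real.log (r + 2))) :=
      add_le_add h1' h2'
    _ = A' * (1 + Real.exp (3 * C')) * X * P * Real.exp (4 * C' * r * Real.log (r + 2)) := by ring

end RightHalfTwinOfDisc

/-- **Barrier: the right half-disc majorant is twin-BLIND.**  If `S_x` obeys the crux's disc
majorant (`DiscMajorantLog`), then so does its parity twin `E_x(z) = S_x(z) + S_x(−z)` on the closed
right half `0 ≤ Re z` of the slightly smaller disc `‖z − 1‖ + 2 ≤ 3 log log x` (so that `−z` lies
in the disc): for `0 ≤ Re z`, `Re(−z) − 1 ≤ Re z − 1` and `‖−z − 1‖ ≤ ‖z − 1‖ + 2`, so the bound for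
`S_x(−z)` is at most `e^{3C'} · e^{4C'‖z−1‖ log(‖z−1‖+2)}` times `A' x (log x)^{k(Re z−1)}`
(`A' = max A 0`, `C' = max C 0`, `x ≥ max x₀ 16`).  Constants: `A'(1 + e^{3C'})`, `4C'`,
`max x₀ 16`.  Hence no argument that cannot distinguish `S_x` from `E_x` refutes the right
half-disc stub. [folklore] -/
theorem stub_rightHalfTwinOfDisc :
    DiscMajorantLog →
    ∀ (k : ℕ) (f : Fin k → Polynomial ℤ), Literature.NumberTheory.Sieve.IsBatemanHornSystem f →
      ∃ A C : ℝ, ∃ x₀ : ℕ, ∀ x : ℕ, x₀ ≤ x → ∀ z : ℂ, ‖z - 1‖ + 2 ≤ 3 * Real.log (Real.log (x : ℝ)) →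
        0 ≤ z.re →
        ‖(∑ n ∈ Finset.range (x + 1), (z : ℂ) ^ (∑ i, (((f i).eval (n : ℤ)).toNat.factorization.sum fun _ v => min v 2))) +
            (∑ n ∈ Finset.range (x + 1), (-z : ℂ) ^ (∑ i, (((f i).eval (n : ℤ)).toNat.factorization.sum fun _ v => min v 2)))‖ ≤
          A * (x : ℝ) * (Real.log (x : ℝ)) ^ ((k : ℝ) * ((z : ℂ).re - 1)) *
            Real.exp (C * ‖(z : ℂ) - 1‖ * Real.log (‖(z : ℂ) - 1‖ + 2)) := by
  intro hD k f hf
  obtain ⟨A, C, x₀, h⟩ := hD k f hf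
  refine ⟨max A 0 * (1 + Real.exp (3 * max C 0)), 4 * max C 0, max x₀ 16,
    fun x hx z hz hre => ?_⟩
  have hx₀ : x₀ ≤ x := le_of_max_le_left hx
  have hx16 : (16 : ℝ) ≤ x := by exact_mod_cast le_of_max_le_right hx
  have hL : 1 ≤ Real.log (x : ℝ) :=
    Literature.NumberTheory.LFunctions.Tao2016.EntropyDecrement.one_le_log hx16
  have hr : 0 ≤ ‖z - 1‖ := norm_nonneg _
  have hr' : ‖-z - 1‖ ≤ ‖z - 1‖ + 2 := RightHalfTwinOfDisc.norm_neg_sub_one_le z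
  -- the majorant at `z` and at the twin point `−z` (which lies in the disc)
  have h₁ := h x hx₀ z (by linarith)
  have h₂ := h x hx₀ (-z) (hr'.trans hz)
  -- the harmonic exponent only improves under `z ↦ −z` on the right half-plane
  have hP : 0 ≤ Real.log (x : ℝ) ^ ((k : ℝ) * (z.re - 1)) := Real.rpow_nonneg (by linarith) _
  have hP'0 : 0 ≤ Real.log (x : ℝ) ^ ((k : ℝ) * ((-z).re - 1)) := Real.rpow_nonneg (by linarith) _
  have hP' : Real.log (x : ℝ) ^ ((k : ℝ) * ((-z).re - 1)) ≤
      Real.log (x : ℝ) ^ ((k : ℝ) * (z.re - 1)) := by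
    apply Real.rpow_le_rpow_of_exponent_le hL
    apply mul_le_mul_of_nonneg_left _ (Nat.cast_nonneg k)
    rw [Complex.neg_re]
    linarith
  exact (norm_add_le _ _).trans
    (RightHalfTwinOfDisc.twin_assemble h₁ h₂ (Nat.cast_nonneg x) hP hP'0 hP' hr (norm_nonneg _) hr')

end Summit.Parity.BatemanHorn.Cruxes.DiscMajorantLog.Sketch

end
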